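import Summits.CriticalPhenomena.PercolationContinuityZ3.Theorems.SahiMasterFamilyPointwiseCoordinateGluingSettled
import Mathlib.Tactic.Linarith
import Mathlib.Tactic.Ring
import HarnessLib

/-!
# `NoHeavyLowerTail` (crux stmt-CriticalPhenomena-4575), master-family line P2: the SATURATION (frontier-transfer) IDENTITY for `E_3` with its explicit
# nonnegative remainder, and the QUANTITATIVE KAHN INEQUALITY `E_3(F,G,H) ≥ μ(H)·μ(F^H∖F)·μ(G^H∖G)` from `C_3` of the saturated triple

Support file (seat `prim-masterthm-p2`, gen 11; `--supports stmt-CriticalPhenomena-4575`); no definition, no sorry.  Memo SAHI-ROUTE.md §4.34(h),(i).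

Let `F, G, H ⊆ 2^ι` be increasing events and let `F' ⊇ F`, `G' ⊇ G` be increasing events that AGREE WITH `F`, `G` INSIDE `H` (`F' ∩ H = F ∩ H`,
`G' ∩ H = G ∩ H`).  With `m = μ_p`, `a = mF' − mF`, `b = mG' − mG` (`sahiE_three_transfer_eq`, a `ring` identity on the seven moments):
  **`E_3(F,G,H) = E_3(F',G',H) + a·Cov(H,G') + b·Cov(H,F') + mH·[m(F'∩G') − m(F∩G)] + mH·a·b`** — every remainder term `≥ 0`.
The largest such `F'` is the `H`-SATURATION `F^H = {ω | every ω' ⊇ ω lying in H lies in F}` (an increasing event containing `F` with `F^H ∩ H = F ∩ H`;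
written inline, no definition): `F = F^H` iff every maximal non-member of `F` belongs to `H` — gen 4's FRONTIER-TERMINAL condition
(`SahiFrontierTransfer.sahiPositive_three_iff_doublyTerminal`, p225369/p226067, proved by one-point transfer moves); this file is the all-at-once identity with
the exact remainder.  CONSEQUENCES: (i) `sahiE_three_ge_transfer`: `E_3(F,G,H) ≥ E_3(F',G',H) + mH·a·b`; in particular **`C_3` for the `H`-saturated triple
`(F^H, G^H, H)` gives the QUANTITATIVE KAHN INEQUALITY `E_3(F,G,H) ≥ μ(H)·μ(F^H∖F)·μ(G^H∖G)`** (`sahiE_three_ge_of_saturated_nonneg`), which is the census-clean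
conjecture (T3) of `…SahiCoordinateTwoThirds` at a coordinate missed by `H` and with `H`-avoiding pivotal sets (memo §4.34(h)); (ii) a minimal counterexample to
Kahn's `C_3` is saturated with respect to each member.
HONEST FRAMING: an identity and its corollaries; Kahn's Conjecture 5 / Sahi's `C_3` remain OPEN.  Axioms standard. [this work]
-/

noncomputable section

open scoped Classical

namespace Summit.CriticalPhenomena.PercolationContinuityZ3.Theorems

namespace SahiSaturation

open Finset Function
open Literature.Combinatorics.Sahi2008
open Literature.Probability.Percolation.DecisionTree (ind ind_of_mem ind_of_not_mem ind_nonneg)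
open SahiCombDisjunct

variable {ι : Type} [Fintype ι]

/-! ### 1. The transfer identity (abstract form: `F ⊆ F'`, `G ⊆ G'` agreeing with `F, G` inside `H`) -/

section Transfer

variable (p : ι → unitInterval) {F F' G G' H : Set (Set ι)} (hFH : F' ∩ H = F ∩ H) (hGH : G' ∩ H = G ∩ H)
include hFH hGH

/-- **The transfer identity.**  If `F' ∩ H = F ∩ H` and `G' ∩ H = G ∩ H` then, with `m = μ_p`, `a = mF' − mF`, `b = mG' − mG`,
`E_3(1_F,1_G,1_H) = E_3(1_{F'},1_{G'},1_H) + a·(m(H∩G') − mH·mG') + b·(m(H∩F') − mH·mF') + mH·(m(F'∩G') − m(F∩G)) + mH·a·b`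
(no monotonicity or containment needed). [this work] -/
theorem sahiE_three_transfer_eq :
    sahiE (bernoulliWeight p) 3 ![ind F, ind G, ind H] =
      sahiE (bernoulliWeight p) 3 ![ind F', ind G', ind H]
      + (ex (bernoulliWeight p) (ind F') - ex (bernoulliWeight p) (ind F)) *
          (ex (bernoulliWeight p) (ind (G' ∩ H)) - ex (bernoulliWeight p) (ind G') * ex (bernoulliWeight p) (ind H))
      + (ex (bernoulliWeight p) (ind G') - ex (bernoulliWeight p) (ind G)) *
          (ex (bernoulliWeight p) (ind (F' ∩ H)) - ex (bernoulliWeight p) (ind F') * ex (bernoulliWeight p) (ind H))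
      + ex (bernoulliWeight p) (ind H) * (ex (bernoulliWeight p) (ind (F' ∩ G')) - ex (bernoulliWeight p) (ind (F ∩ G)))
      + ex (bernoulliWeight p) (ind H) * (ex (bernoulliWeight p) (ind F') - ex (bernoulliWeight p) (ind F))
          * (ex (bernoulliWeight p) (ind G') - ex (bernoulliWeight p) (ind G)) := by
  have h1 : ex (bernoulliWeight p) (ind (F ∩ H)) = ex (bernoulliWeight p) (ind (F' ∩ H)) := by rw [hFH]
  have h2 : ex (bernoulliWeight p) (ind (G ∩ H)) = ex (bernoulliWeight p) (ind (G' ∩ H)) := by rw [hGH]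
  have h3 : ex (bernoulliWeight p) (ind (F ∩ G ∩ H)) = ex (bernoulliWeight p) (ind (F' ∩ G' ∩ H)) := by
    have hs : F ∩ G ∩ H = F' ∩ G' ∩ H := by
      ext ω
      constructor
      · rintro ⟨⟨hF, hG⟩, hH⟩
        have hF' : ω ∈ F' ∩ H := by rw [hFH]; exact ⟨hF, hH⟩
        have hG' : ω ∈ G' ∩ H := by rw [hGH]; exact ⟨hG, hH⟩
        exact ⟨⟨hF'.1, hG'.1⟩, hH⟩
      · rintro ⟨⟨hF', hG'⟩, hH⟩
        have hF : ω ∈ F ∩ H := by rw [← hFH]; exact ⟨hF', hH⟩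
        have hG : ω ∈ G ∩ H := by rw [← hGH]; exact ⟨hG', hH⟩
        exact ⟨⟨hF.1, hG.1⟩, hH⟩
    rw [hs]
  rw [sahiE_three, sahiE_three]
  simp only [ind_mul_ind_eq_inter]
  rw [h1, h2, h3]
  ring

/-- **Monotonicity under transfer** for increasing events: `E_3(F,G,H) ≥ E_3(F',G',H) + mH·(mF'−mF)(mG'−mG)` when `F ⊆ F'`, `G ⊆ G'` are increasing and
agree with `F, G` inside `H`. [this work] -/
theorem sahiE_three_ge_transfer (hF' : IsUpperSet F') (hG' : IsUpperSet G') (hH : IsUpperSet H) (hFF' : F ⊆ F') (hGG' : G ⊆ G') :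
    sahiE (bernoulliWeight p) 3 ![ind F', ind G', ind H]
      + ex (bernoulliWeight p) (ind H) * (ex (bernoulliWeight p) (ind F') - ex (bernoulliWeight p) (ind F))
          * (ex (bernoulliWeight p) (ind G') - ex (bernoulliWeight p) (ind G))
      ≤ sahiE (bernoulliWeight p) 3 ![ind F, ind G, ind H] := by
  rw [sahiE_three_transfer_eq p hFH hGH]
  have a0 : 0 ≤ ex (bernoulliWeight p) (ind F') - ex (bernoulliWeight p) (ind F) := by
    rw [Pointwise.ex_ind_sub_of_subset _ hFF']; exact ex_ind_nonneg' p _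
  have b0 : 0 ≤ ex (bernoulliWeight p) (ind G') - ex (bernoulliWeight p) (ind G) := by
    rw [Pointwise.ex_ind_sub_of_subset _ hGG']; exact ex_ind_nonneg' p _
  have cG : 0 ≤ ex (bernoulliWeight p) (ind (G' ∩ H)) - ex (bernoulliWeight p) (ind G') * ex (bernoulliWeight p) (ind H) :=
    Pointwise.cov_ind_nonneg p hG' hH
  have cF : 0 ≤ ex (bernoulliWeight p) (ind (F' ∩ H)) - ex (bernoulliWeight p) (ind F') * ex (bernoulliWeight p) (ind H) :=
    Pointwise.cov_ind_nonneg p hF' hH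
  have mH : 0 ≤ ex (bernoulliWeight p) (ind H) := ex_ind_nonneg' p _
  have dFG : 0 ≤ ex (bernoulliWeight p) (ind (F' ∩ G')) - ex (bernoulliWeight p) (ind (F ∩ G)) := by
    rw [Pointwise.ex_ind_sub_of_subset _ (Set.inter_subset_inter hFF' hGG')]; exact ex_ind_nonneg' p _
  have t1 := mul_nonneg a0 cG
  have t2 := mul_nonneg b0 cF
  have t3 := mul_nonneg mH dFG
  linarith

/-- **`C_3` passes down a transfer, quantitatively**: `0 ≤ E_3(F',G',H) ⟹ mH·(mF'−mF)(mG'−mG) ≤ E_3(F,G,H)`. [this work] -/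
theorem sahiE_three_ge_of_transfer_nonneg (hF' : IsUpperSet F') (hG' : IsUpperSet G') (hH : IsUpperSet H) (hFF' : F ⊆ F') (hGG' : G ⊆ G')
    (h' : 0 ≤ sahiE (bernoulliWeight p) 3 ![ind F', ind G', ind H]) :
    ex (bernoulliWeight p) (ind H) * (ex (bernoulliWeight p) (ind F') - ex (bernoulliWeight p) (ind F))
        * (ex (bernoulliWeight p) (ind G') - ex (bernoulliWeight p) (ind G))
      ≤ sahiE (bernoulliWeight p) 3 ![ind F, ind G, ind H] := by
  have h := sahiE_three_ge_transfer p hFH hGH hF' hG' hH hFF' hGG'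
  linarith

end Transfer

/-! ### 2. The `H`-saturation of an increasing event (written inline) -/

omit [Fintype ι] in
/-- The `H`-saturation `{ω | ∀ ω' ⊇ ω, ω' ∈ H → ω' ∈ F}` is increasing. [this work] -/
theorem isUpperSet_saturation (F H : Set (Set ι)) :
    IsUpperSet {ω : Set ι | ∀ ω' : Set ι, ω ⊆ ω' → ω' ∈ H → ω' ∈ F} :=
  fun _ _ hle hω ω' h' hH => hω ω' (Set.Subset.trans hle h') hH

omit [Fintype ι] in
/-- An increasing event is contained in its `H`-saturation. [this work] -/
theorem subset_saturation {F : Set (Set ι)} (hF : IsUpperSet F) (H : Set (Set ι)) :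
    F ⊆ {ω : Set ι | ∀ ω' : Set ι, ω ⊆ ω' → ω' ∈ H → ω' ∈ F} :=
  fun _ hω _ h' _ => hF h' hω

omit [Fintype ι] in
/-- The `H`-saturation agrees with `F` inside `H`. [this work] -/
theorem saturation_inter {F : Set (Set ι)} (hF : IsUpperSet F) (H : Set (Set ι)) :
    {ω : Set ι | ∀ ω' : Set ι, ω ⊆ ω' → ω' ∈ H → ω' ∈ F} ∩ H = F ∩ H := by
  ext ω
  constructor
  · rintro ⟨hω, hH⟩
    exact ⟨hω ω (Set.Subset.refl ω) hH, hH⟩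
  · rintro ⟨hω, hH⟩
    exact ⟨subset_saturation hF H hω, hH⟩

/-- **QUANTITATIVE KAHN INEQUALITY from `C_3` of the saturated triple.**  For increasing `F, G, H`, writing `F^H = {ω | ∀ ω' ⊇ ω, ω' ∈ H → ω' ∈ F}`
(the largest increasing event agreeing with `F` inside `H`) and `G^H` likewise:
`0 ≤ E_3(F^H, G^H, H) ⟹ μ(H)·(μF^H − μF)·(μG^H − μG) ≤ E_3(F, G, H)`. [this work] -/
theorem sahiE_three_ge_of_saturated_nonneg (p : ι → unitInterval) {F G H : Set (Set ι)} (hF : IsUpperSet F) (hG : IsUpperSet G)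
    (hH : IsUpperSet H)
    (hsat : 0 ≤ sahiE (bernoulliWeight p) 3
      ![ind {ω : Set ι | ∀ ω' : Set ι, ω ⊆ ω' → ω' ∈ H → ω' ∈ F}, ind {ω : Set ι | ∀ ω' : Set ι, ω ⊆ ω' → ω' ∈ H → ω' ∈ G}, ind H]) :
    ex (bernoulliWeight p) (ind H)
        * (ex (bernoulliWeight p) (ind {ω : Set ι | ∀ ω' : Set ι, ω ⊆ ω' → ω' ∈ H → ω' ∈ F}) - ex (bernoulliWeight p) (ind F))
        * (ex (bernoulliWeight p) (ind {ω : Set ι | ∀ ω' : Set ι, ω ⊆ ω' → ω' ∈ H → ω' ∈ G}) - ex (bernoulliWeight p) (ind G))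
      ≤ sahiE (bernoulliWeight p) 3 ![ind F, ind G, ind H] :=
  sahiE_three_ge_of_transfer_nonneg p (saturation_inter hF H) (saturation_inter hG H) (isUpperSet_saturation F H) (isUpperSet_saturation G H) hH
    (subset_saturation hF H) (subset_saturation hG H) hsat

/-- **`C_3` for the original triple from `C_3` for the saturated one** (the frontier transfer, all at once). [this work] -/
theorem sahiE_three_nonneg_of_saturated_nonneg (p : ι → unitInterval) {F G H : Set (Set ι)} (hF : IsUpperSet F) (hG : IsUpperSet G)
    (hH : IsUpperSet H)
    (hsat : 0 ≤ sahiE (bernoulliWeight p) 3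
      ![ind {ω : Set ι | ∀ ω' : Set ι, ω ⊆ ω' → ω' ∈ H → ω' ∈ F}, ind {ω : Set ι | ∀ ω' : Set ι, ω ⊆ ω' → ω' ∈ H → ω' ∈ G}, ind H]) :
    0 ≤ sahiE (bernoulliWeight p) 3 ![ind F, ind G, ind H] := by
  have h := sahiE_three_ge_of_saturated_nonneg p hF hG hH hsat
  have a0 : 0 ≤ ex (bernoulliWeight p) (ind {ω : Set ι | ∀ ω' : Set ι, ω ⊆ ω' → ω' ∈ H → ω' ∈ F}) - ex (bernoulliWeight p) (ind F) := by
    rw [Pointwise.ex_ind_sub_of_subset _ (subset_saturation hF H)]; exact ex_ind_nonneg' p _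
  have b0 : 0 ≤ ex (bernoulliWeight p) (ind {ω : Set ι | ∀ ω' : Set ι, ω ⊆ ω' → ω' ∈ H → ω' ∈ G}) - ex (bernoulliWeight p) (ind G) := by
    rw [Pointwise.ex_ind_sub_of_subset _ (subset_saturation hG H)]; exact ex_ind_nonneg' p _
  have mH : 0 ≤ ex (bernoulliWeight p) (ind H) := ex_ind_nonneg' p _
  have := mul_nonneg (mul_nonneg mH a0) b0
  linarith

end SahiSaturation

end Summit.CriticalPhenomena.PercolationContinuityZ3.Theorems
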